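import Literature.Analysis.Complex.HolomorphicParametricIntegral
import Mathlib.Analysis.Complex.CauchyIntegral
import Mathlib.Analysis.Complex.LocallyUniformLimit
import Mathlib.Analysis.Normed.Module.DoubleDual
import Mathlib.Analysis.InnerProductSpace.Dual
import Literature.Analysis.Complex.OsgoodSeparate
import Literature.Analysis.Complex.LocallyUniformLimitSCV
import Mathlib.Analysis.Calculus.FDeriv.Pi
import HarnessLib

/-!
# Weakly holomorphic vector-valued functions are holomorphic (Dunford)

Analysis/Complex support file (everything proved; no definitions, no named facts). Let `F` be a
complex Banach space and `f : ℂ → F` a function on an open set `U` which is **locally bounded** and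
**weakly holomorphic**: `z ↦ φ (f z)` is holomorphic on `U` for every continuous linear functional
`φ`. Then:

* `norm_sub_le_of_weakly_holomorphic` — **Lipschitz estimate**: if `‖f‖ ≤ M` on `ball c R` then
  `‖f z − f w‖ ≤ (4M/R) ‖z − w‖` on `ball c (R/2)` (Cauchy's estimate for the scalar functions
  `φ ∘ f`, `‖φ ∘ f‖ ≤ ‖φ‖ M`, the mean value inequality, and the norm through the dual,
  `NormedSpace.norm_le_dual_bound`); hence `f` is continuous on `U`
  (`continuousOn_of_weakly_holomorphic`);
* `eq_cauchyIntegral_of_weakly_holomorphic` — **Cauchy's formula** holds for `f` itself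
  (functionals commute with the circle integral and separate points);
* `differentiableOn_of_weakly_holomorphic`, `analyticOnNhd_of_weakly_holomorphic` — **`f` is
  holomorphic**, indeed analytic, on `U` (the Cauchy integral has a power series,
  `hasFPowerSeriesOn_cauchy_integral`);
* Hilbert-space forms (`H` a complex Hilbert space): it suffices that `z ↦ ⟪v, f z⟫` be holomorphic
  for all `v` in a set `K` whose span is dense (`differentiableOn_of_inner_of_dense`,
  `continuousOn_of_inner_of_dense`), the passage to the closed span being by locally uniform
  limits (`differentiableOn_inner_of_mem_topologicalClosure_span`; the sequential step
  `differentiableOn_inner_of_tendsto_of_locallyBounded` is the general-analysis home of the lemma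
  proved for the Glaser vectors in
  `Literature.MathematicalPhysics.QuantumFieldTheory.differentiableOn_inner_of_tendsto`
  (`OSGlaserHolomorphy`), whose heavy imports are not wanted here).

* **several variables** (`f : ℂⁿ ⊇ U → F`): the Lipschitz estimate and continuity hold verbatim on
  any complex normed parameter space (`norm_sub_le_of_weakly_holomorphic'`,
  `continuousOn_of_weakly_holomorphic'`), and with the one-variable theorem on the coordinate
  slices and Osgood's lemma (`Literature.Analysis.Complex.SCV.differentiableOn_of_continuousOn_of_differentiableOn_update`)
  a locally bounded weakly holomorphic map on an open `U ⊆ ℂⁿ` is jointly holomorphic / analytic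
  (`differentiableOn_of_weakly_holomorphic_pi`, `analyticOnNhd_of_weakly_holomorphic_pi`);
  Hilbert forms `differentiableOn_of_inner_of_dense_pi`, `continuousOn_of_inner_of_dense_pi`
  (closed span by locally uniform limits in several variables,
  `Literature.Analysis.Complex.SCV.differentiableOn_of_tendstoLocallyUniformlyOn`).

This is N. Dunford's theorem (weak = strong holomorphy for locally bounded maps; without the local
boundedness hypothesis it follows from the uniform boundedness principle, not needed here) — the
form in which vector-valued analytic continuation arguments produce *norm*-continuous and
holomorphic Hilbert-space valued maps from holomorphy of matrix elements (e.g. the vectors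
`Ψ_n(x, ζ)` of Osterwalder–Schrader II, Ch. V.2 (P_N), known through `⟪v, Ψ(ζ)⟫`). Classical:
E. Hille, R. S. Phillips, *Functional Analysis and Semi-Groups* (1957), Thm. 3.10.1; W. Rudin,
*Functional Analysis*, Thm. 3.31; folklore.

## Mathlib

`Complex.two_pi_I_inv_smul_circleIntegral_sub_inv_smul_of_differentiable_on_off_countable`,
`hasFPowerSeriesOn_cauchy_integral`, `ContinuousLinearMap.intervalIntegral_comp_comm`,
`NormedSpace.norm_le_dual_bound`, `SeparatingDual.eq_zero_of_forall_dual_eq_zero`,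
`Convex.norm_image_sub_le_of_norm_fderiv_le`, `InnerProductSpace.toDual`; the tree's Cauchy
estimate `Literature.Analysis.Complex.norm_fderiv_le_of_forall_mem_ball_norm_le`. Mathlib has no
statement on weakly holomorphic maps (searched `weakly holomorphic`, `Dunford`).
-/

noncomputable section

open MeasureTheory Metric Set Filter Complex
open _root_.Topology
open scoped InnerProductSpace NNReal

namespace Literature.Analysis.Complex

variable {F : Type*} [NormedAddCommGroup F] [NormedSpace ℂ F]

/-! ### The Lipschitz estimate and continuity -/

/-- **Lipschitz estimate for a bounded weakly holomorphic map**: if `φ ∘ f` is holomorphic on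
`ball c R` for every functional `φ` and `‖f‖ ≤ M` there, then
`‖f z − f w‖ ≤ (4M/R) ‖z − w‖` for `z, w ∈ ball c (R/2)`. [folklore] -/
theorem norm_sub_le_of_weakly_holomorphic {f : ℂ → F} {c : ℂ} {R M : ℝ} (hR : 0 < R)
    (hw : ∀ φ : StrongDual ℂ F, DifferentiableOn ℂ (fun z => φ (f z)) (ball c R))
    (hM : ∀ z ∈ ball c R, ‖f z‖ ≤ M) {z w : ℂ} (hz : z ∈ ball c (R / 2))
    (hw' : w ∈ ball c (R / 2)) : ‖f z - f w‖ ≤ 4 * M / R * ‖z - w‖ := by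
  have hM0 : 0 ≤ M := (norm_nonneg _).trans (hM c (mem_ball_self hR))
  have hC : 0 ≤ 4 * M / R * ‖z - w‖ := by positivity
  refine NormedSpace.norm_le_dual_bound ℂ (f z - f w) hC fun φ => ?_
  -- the scalar function φ ∘ f: bounded by ‖φ‖ M, derivative ≤ 4 ‖φ‖ M / R on the half ball
  set g : ℂ → ℂ := fun x => φ (f x) with hg
  have hgb : ∀ x ∈ ball c R, ‖g x‖ ≤ ‖φ‖ * M := fun x hx =>
    (φ.le_opNorm _).trans (mul_le_mul_of_nonneg_left (hM x hx) (norm_nonneg _))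
  have hD : ∀ x ∈ ball c (R / 2), ‖fderiv ℂ g x‖ ≤ 4 * (‖φ‖ * M) / R := by
    intro x hx
    have hsub : ball x (R / 2) ⊆ ball c R := by
      intro y hy
      rw [mem_ball] at hx hy ⊢
      linarith [dist_triangle y x c]
    have h := norm_fderiv_le_of_forall_mem_ball_norm_le (f := g) (c := x) (R := R / 2)
      (M := ‖φ‖ * M) (by positivity) ((hw φ).mono hsub) fun y hy => hgb y (hsub hy)
    calc ‖fderiv ℂ g x‖ ≤ 2 * (‖φ‖ * M) / (R / 2) := h
      _ = 4 * (‖φ‖ * M) / R := by field_simp; ring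
  have hdiff : ∀ x ∈ ball c (R / 2), DifferentiableAt ℂ g x := fun x hx =>
    (hw φ).differentiableAt (isOpen_ball.mem_nhds (ball_subset_ball (by linarith) hx))
  have hmv := (convex_ball c (R / 2)).norm_image_sub_le_of_norm_fderiv_le hdiff hD hw' hz
  rw [map_sub]
  calc ‖φ (f z) - φ (f w)‖ = ‖g z - g w‖ := rfl
    _ ≤ 4 * (‖φ‖ * M) / R * ‖z - w‖ := hmv
    _ = 4 * M / R * ‖z - w‖ * ‖φ‖ := by ring

/-- **A locally bounded weakly holomorphic map is continuous** (indeed locally Lipschitz). [folklore] -/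
theorem continuousOn_of_weakly_holomorphic {f : ℂ → F} {U : Set ℂ} (hU : IsOpen U)
    (hw : ∀ φ : StrongDual ℂ F, DifferentiableOn ℂ (fun z => φ (f z)) U)
    (hb : ∀ z₀ ∈ U, ∃ r > 0, ∃ C : ℝ, ∀ z ∈ ball z₀ r, ‖f z‖ ≤ C) : ContinuousOn f U := by
  intro z₀ hz₀
  obtain ⟨r, hr, C, hC⟩ := hb z₀ hz₀
  obtain ⟨ε, hε, hεU⟩ := Metric.isOpen_iff.1 hU z₀ hz₀
  set R := min r ε with hRdef
  have hR : 0 < R := lt_min hr hε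
  have hRU : ball z₀ R ⊆ U := (ball_subset_ball (min_le_right _ _)).trans hεU
  have hRr : ball z₀ R ⊆ ball z₀ r := ball_subset_ball (min_le_left _ _)
  have hlip : ∀ z ∈ ball z₀ (R / 2), ‖f z - f z₀‖ ≤ 4 * C / R * ‖z - z₀‖ := fun z hz =>
    norm_sub_le_of_weakly_holomorphic hR (fun φ => (hw φ).mono hRU) (fun z hz => hC z (hRr hz))
      hz (mem_ball_self (by positivity))
  refine ContinuousAt.continuousWithinAt ?_
  rw [ContinuousAt, tendsto_iff_norm_sub_tendsto_zero]
  have h0 : Tendsto (fun z : ℂ => 4 * C / R * ‖z - z₀‖) (𝓝 z₀) (𝓝 0) := by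
    simpa using (tendsto_norm_sub_self z₀).const_mul (4 * C / R)
  refine squeeze_zero_norm' ?_ h0
  filter_upwards [isOpen_ball.mem_nhds (mem_ball_self (by positivity : (0 : ℝ) < R / 2))]
    with z hz
  rw [norm_norm]
  exact hlip z hz

/-! ### Cauchy's formula and holomorphy -/

/-- **Cauchy's integral formula for a weakly holomorphic map**: if `f` is continuous on
`closedBall c R ⊆ U` (e.g. by `continuousOn_of_weakly_holomorphic`) and weakly holomorphic on
`U`, then `f w = (2πi)⁻¹ ∮_{|z−c|=R} (z − w)⁻¹ f(z) dz` for `|w − c| < R`. [folklore] -/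
theorem eq_cauchyIntegral_of_weakly_holomorphic [CompleteSpace F] {f : ℂ → F} {U : Set ℂ} {c : ℂ} {R : ℝ}
    (hR : 0 < R) (hRU : closedBall c R ⊆ U)
    (hw : ∀ φ : StrongDual ℂ F, DifferentiableOn ℂ (fun z => φ (f z)) U)
    (hc : ContinuousOn f (closedBall c R)) {w : ℂ} (hwc : w ∈ ball c R) :
    f w = (2 * Real.pi * I : ℂ)⁻¹ • ∮ z in C(c, R), (z - w)⁻¹ • f z := by
  -- test against functionals
  rw [← sub_eq_zero]
  refine SeparatingDual.eq_zero_of_forall_dual_eq_zero (R := ℂ) fun φ => ?_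
  rw [map_sub, sub_eq_zero, map_smul]
  -- φ commutes with the circle integral
  have hci : CircleIntegrable (fun z => (z - w)⁻¹ • f z) c R := by
    refine ContinuousOn.circleIntegrable hR.le ?_
    refine ContinuousOn.smul ?_ (hc.mono sphere_subset_closedBall)
    have hne : ∀ z ∈ sphere c R, z - w ≠ 0 := by
      intro z hz h
      rw [sub_eq_zero] at h
      rw [h, mem_sphere] at hz
      rw [mem_ball] at hwc
      linarith
    exact ContinuousOn.inv₀ (by fun_prop) hne
  have hcomm : φ (∮ z in C(c, R), (z - w)⁻¹ • f z) = ∮ z in C(c, R), (z - w)⁻¹ • φ (f z) := by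
    rw [circleIntegral, circleIntegral, ← φ.intervalIntegral_comp_comm hci.out]
    simp only [map_smul]
  rw [hcomm]
  -- Cauchy's formula for the scalar function φ ∘ f
  have hφc : ContinuousOn (fun z => φ (f z)) (closedBall c R) := φ.continuous.comp_continuousOn hc
  have hφd : ∀ x ∈ ball c R \ ∅, DifferentiableAt ℂ (fun z => φ (f z)) x := fun x hx =>
    (hw φ).differentiableAt (Filter.mem_of_superset (isOpen_ball.mem_nhds hx.1)
      (ball_subset_closedBall.trans hRU))
  exact (Complex.two_pi_I_inv_smul_circleIntegral_sub_inv_smul_of_differentiable_on_off_countable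
    countable_empty hwc hφc hφd).symm

/-- **Dunford's theorem: a locally bounded weakly holomorphic map into a Banach space is
holomorphic.** [folklore] -/
theorem differentiableOn_of_weakly_holomorphic [CompleteSpace F] {f : ℂ → F} {U : Set ℂ} (hU : IsOpen U)
    (hw : ∀ φ : StrongDual ℂ F, DifferentiableOn ℂ (fun z => φ (f z)) U)
    (hb : ∀ z₀ ∈ U, ∃ r > 0, ∃ C : ℝ, ∀ z ∈ ball z₀ r, ‖f z‖ ≤ C) : DifferentiableOn ℂ f U := by
  have hcont := continuousOn_of_weakly_holomorphic hU hw hb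
  intro z₀ hz₀
  obtain ⟨ε, hε, hεU⟩ := Metric.isOpen_iff.1 hU z₀ hz₀
  set R : ℝ≥0 := ⟨ε / 2, by positivity⟩ with hRdef
  have hRe : (R : ℝ) = ε / 2 := rfl
  have hR : (0 : ℝ) < R := by rw [hRe]; positivity
  have hR' : 0 < R := by exact_mod_cast hR
  have hRU : closedBall z₀ R ⊆ U := by
    refine (closedBall_subset_ball ?_).trans hεU
    rw [hRe]; linarith
  -- the Cauchy integral has a power series on the ball, and equals f there
  have hci : CircleIntegrable f z₀ R :=
    (hcont.mono (sphere_subset_closedBall.trans hRU)).circleIntegrable hR.le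
  have hps := hasFPowerSeriesOn_cauchy_integral hci hR'
  have hdiff : DifferentiableOn ℂ
      (fun w => (2 * Real.pi * I : ℂ)⁻¹ • ∮ z in C(z₀, R), (z - w)⁻¹ • f z) (ball z₀ R) := by
    simpa using hps.differentiableOn
  have heq : ∀ w ∈ ball z₀ (R : ℝ),
      f w = (2 * Real.pi * I : ℂ)⁻¹ • ∮ z in C(z₀, R), (z - w)⁻¹ • f z := fun w hw' =>
    eq_cauchyIntegral_of_weakly_holomorphic hR hRU hw (hcont.mono hRU) hw'
  have hfd : DifferentiableOn ℂ f (ball z₀ R) := hdiff.congr heq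
  have hball : ball z₀ (R : ℝ) ∈ 𝓝 z₀ := isOpen_ball.mem_nhds (mem_ball_self hR)
  exact (hfd.differentiableAt hball).differentiableWithinAt

/-- A locally bounded weakly holomorphic map into a Banach space is analytic. [folklore] -/
theorem analyticOnNhd_of_weakly_holomorphic [CompleteSpace F] {f : ℂ → F} {U : Set ℂ} (hU : IsOpen U)
    (hw : ∀ φ : StrongDual ℂ F, DifferentiableOn ℂ (fun z => φ (f z)) U)
    (hb : ∀ z₀ ∈ U, ∃ r > 0, ∃ C : ℝ, ∀ z ∈ ball z₀ r, ‖f z‖ ≤ C) : AnalyticOnNhd ℂ f U :=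
  (differentiableOn_of_weakly_holomorphic hU hw hb).analyticOnNhd hU

/-! ### Hilbert-space forms: matrix elements against a dense set of vectors -/

section Hilbert

variable {H : Type*} [NormedAddCommGroup H] [InnerProductSpace ℂ H]

/-- **Weak holomorphy passes to limits of the test vectors** under local boundedness: if
`‖f‖` is locally bounded on the open set `U`, `vⱼ → v`, and each `z ↦ ⟪vⱼ, f z⟫` is holomorphic
on `U`, then so is `z ↦ ⟪v, f z⟫` (locally uniform convergence). [folklore] -/
theorem differentiableOn_inner_of_tendsto_of_locallyBounded {f : ℂ → H} {U : Set ℂ} (hU : IsOpen U)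
    (hb : ∀ z₀ ∈ U, ∃ r > 0, ∃ C : ℝ, ∀ z ∈ ball z₀ r, ‖f z‖ ≤ C)
    {v : ℕ → H} {v₀ : H} (hv : Tendsto v atTop (𝓝 v₀))
    (hhol : ∀ j, DifferentiableOn ℂ (fun z => ⟪v j, f z⟫_ℂ) U) :
    DifferentiableOn ℂ (fun z => ⟪v₀, f z⟫_ℂ) U := by
  have hunif : TendstoLocallyUniformlyOn (fun j z => ⟪v j, f z⟫_ℂ) (fun z => ⟪v₀, f z⟫_ℂ)
      atTop U := by
    rw [Metric.tendstoLocallyUniformlyOn_iff]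
    intro ε hε z₀ hz₀
    obtain ⟨r, hr, C, hC⟩ := hb z₀ hz₀
    refine ⟨ball z₀ r, mem_nhdsWithin_of_mem_nhds (ball_mem_nhds _ hr), ?_⟩
    have hC0 : 0 ≤ C := (norm_nonneg _).trans (hC z₀ (mem_ball_self hr))
    have hδ : 0 < ε / (C + 1) := by positivity
    have hev : ∀ᶠ j in atTop, dist (v j) v₀ < ε / (C + 1) := (Metric.tendsto_nhds.1 hv) _ hδ
    filter_upwards [hev] with j hj y hy
    rw [dist_eq_norm] at hj
    rw [dist_eq_norm, ← inner_sub_left]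
    calc ‖⟪v₀ - v j, f y⟫_ℂ‖ ≤ ‖v₀ - v j‖ * ‖f y‖ := norm_inner_le_norm _ _
      _ ≤ ε / (C + 1) * C := by
          rw [norm_sub_rev]
          exact mul_le_mul hj.le (hC y hy) (norm_nonneg _) hδ.le
      _ < ε := by
          rw [div_mul_eq_mul_div, div_lt_iff₀ (by positivity)]
          nlinarith
  exact hunif.differentiableOn (Eventually.of_forall hhol) hU

/-- **Weak holomorphy against the closed span**: if `‖f‖` is locally bounded on the open `U` and
`z ↦ ⟪v, f z⟫` is holomorphic for every `v ∈ K`, then it is holomorphic for every `v` in the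
topological closure of the span of `K`. [folklore] -/
theorem differentiableOn_inner_of_mem_topologicalClosure_span {f : ℂ → H} {U : Set ℂ}
    (hU : IsOpen U) (hb : ∀ z₀ ∈ U, ∃ r > 0, ∃ C : ℝ, ∀ z ∈ ball z₀ r, ‖f z‖ ≤ C) {K : Set H}
    (hhol : ∀ v ∈ K, DifferentiableOn ℂ (fun z => ⟪v, f z⟫_ℂ) U) {v : H}
    (hv : v ∈ (Submodule.span ℂ K).topologicalClosure) :
    DifferentiableOn ℂ (fun z => ⟪v, f z⟫_ℂ) U := by
  -- first the algebraic span
  have hspan : ∀ u ∈ Submodule.span ℂ K, DifferentiableOn ℂ (fun z => ⟪u, f z⟫_ℂ) U := by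
    intro u hu
    induction hu using Submodule.span_induction with
    | mem u hu => exact hhol u hu
    | zero => simp only [inner_zero_left]; exact differentiableOn_const _
    | add u u' _ _ hu hu' =>
      simp only [inner_add_left]; exact hu.add hu'
    | smul a u _ hu =>
      simp only [inner_smul_left]; exact hu.const_mul _
  -- then its closure, by sequences
  have hv' : v ∈ closure (Submodule.span ℂ K : Set H) := by
    rw [← Submodule.topologicalClosure_coe]; exact hv
  obtain ⟨u, hu, hux⟩ := mem_closure_iff_seq_limit.1 hv'
  exact differentiableOn_inner_of_tendsto_of_locallyBounded hU hb hux fun j => hspan _ (hu j)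

/-- **Holomorphy from matrix elements**: if `f : ℂ → H` is locally bounded on the open set `U`
and `z ↦ ⟪v, f z⟫` is holomorphic on `U` for all `v` in a set `K` with dense span, then `f` is
holomorphic on `U` (norm sense). [folklore] -/
theorem differentiableOn_of_inner_of_dense [CompleteSpace H] {f : ℂ → H} {U : Set ℂ} (hU : IsOpen U)
    (hb : ∀ z₀ ∈ U, ∃ r > 0, ∃ C : ℝ, ∀ z ∈ ball z₀ r, ‖f z‖ ≤ C) {K : Set H}
    (hK : (Submodule.span ℂ K).topologicalClosure = ⊤)
    (hhol : ∀ v ∈ K, DifferentiableOn ℂ (fun z => ⟪v, f z⟫_ℂ) U) : DifferentiableOn ℂ f U := by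
  refine differentiableOn_of_weakly_holomorphic hU (fun φ => ?_) hb
  -- every functional is ⟪v, ·⟫
  set v : H := (InnerProductSpace.toDual ℂ H).symm φ with hvdef
  have hφ : ∀ x, φ x = ⟪v, x⟫_ℂ := fun x => by
    rw [hvdef, ← InnerProductSpace.toDual_apply_apply, LinearIsometryEquiv.apply_symm_apply]
  simp only [hφ]
  exact differentiableOn_inner_of_mem_topologicalClosure_span hU hb hhol (by rw [hK]; trivial)

/-- **Norm continuity from matrix elements**: under the hypotheses of
`differentiableOn_of_inner_of_dense`, `f` is norm-continuous on `U`. [folklore] -/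
theorem continuousOn_of_inner_of_dense [CompleteSpace H] {f : ℂ → H} {U : Set ℂ} (hU : IsOpen U)
    (hb : ∀ z₀ ∈ U, ∃ r > 0, ∃ C : ℝ, ∀ z ∈ ball z₀ r, ‖f z‖ ≤ C) {K : Set H}
    (hK : (Submodule.span ℂ K).topologicalClosure = ⊤)
    (hhol : ∀ v ∈ K, DifferentiableOn ℂ (fun z => ⟪v, f z⟫_ℂ) U) : ContinuousOn f U :=
  (differentiableOn_of_inner_of_dense hU hb hK hhol).continuousOn

/-- The all-vectors form: if `z ↦ ⟪v, f z⟫` is holomorphic on `U` for every `v` and `f` is locally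
bounded, then `f` is holomorphic on `U`. [folklore] -/
theorem differentiableOn_of_forall_inner [CompleteSpace H] {f : ℂ → H} {U : Set ℂ} (hU : IsOpen U)
    (hb : ∀ z₀ ∈ U, ∃ r > 0, ∃ C : ℝ, ∀ z ∈ ball z₀ r, ‖f z‖ ≤ C)
    (hhol : ∀ v : H, DifferentiableOn ℂ (fun z => ⟪v, f z⟫_ℂ) U) : DifferentiableOn ℂ f U :=
  differentiableOn_of_inner_of_dense hU hb (K := Set.univ)
    (by rw [Submodule.span_univ]; exact top_le_iff.1 (Submodule.le_topologicalClosure ⊤))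
    fun v _ => hhol v

end Hilbert


/-! ### Several complex variables -/

section SCV

variable {P : Type*} [NormedAddCommGroup P] [NormedSpace ℂ P]

/-- **Lipschitz estimate, any complex normed parameter space**: if `φ ∘ f` is holomorphic on
`ball c R ⊆ P` for every functional `φ` and `‖f‖ ≤ M` there, then
`‖f z − f w‖ ≤ (4M/R) ‖z − w‖` on `ball c (R/2)`. [folklore] -/
theorem norm_sub_le_of_weakly_holomorphic' {f : P → F} {c : P} {R M : ℝ} (hR : 0 < R)
    (hw : ∀ φ : StrongDual ℂ F, DifferentiableOn ℂ (fun z => φ (f z)) (ball c R))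
    (hM : ∀ z ∈ ball c R, ‖f z‖ ≤ M) {z w : P} (hz : z ∈ ball c (R / 2))
    (hw' : w ∈ ball c (R / 2)) : ‖f z - f w‖ ≤ 4 * M / R * ‖z - w‖ := by
  have hM0 : 0 ≤ M := (norm_nonneg _).trans (hM c (mem_ball_self hR))
  have hC : 0 ≤ 4 * M / R * ‖z - w‖ := by positivity
  refine NormedSpace.norm_le_dual_bound ℂ (f z - f w) hC fun φ => ?_
  set g : P → ℂ := fun x => φ (f x) with hg
  have hgb : ∀ x ∈ ball c R, ‖g x‖ ≤ ‖φ‖ * M := fun x hx =>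
    (φ.le_opNorm _).trans (mul_le_mul_of_nonneg_left (hM x hx) (norm_nonneg _))
  have hD : ∀ x ∈ ball c (R / 2), ‖fderiv ℂ g x‖ ≤ 4 * (‖φ‖ * M) / R := by
    intro x hx
    have hsub : ball x (R / 2) ⊆ ball c R := by
      intro y hy
      rw [mem_ball] at hx hy ⊢
      linarith [dist_triangle y x c]
    have h := norm_fderiv_le_of_forall_mem_ball_norm_le (f := g) (c := x) (R := R / 2)
      (M := ‖φ‖ * M) (by positivity) ((hw φ).mono hsub) fun y hy => hgb y (hsub hy)
    calc ‖fderiv ℂ g x‖ ≤ 2 * (‖φ‖ * M) / (R / 2) := h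
      _ = 4 * (‖φ‖ * M) / R := by field_simp; ring
  have hdiff : ∀ x ∈ ball c (R / 2), DifferentiableAt ℂ g x := fun x hx =>
    (hw φ).differentiableAt (isOpen_ball.mem_nhds (ball_subset_ball (by linarith) hx))
  have hmv := (convex_ball c (R / 2)).norm_image_sub_le_of_norm_fderiv_le hdiff hD hw' hz
  rw [map_sub]
  calc ‖φ (f z) - φ (f w)‖ = ‖g z - g w‖ := rfl
    _ ≤ 4 * (‖φ‖ * M) / R * ‖z - w‖ := hmv
    _ = 4 * M / R * ‖z - w‖ * ‖φ‖ := by ring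

/-- **A locally bounded weakly holomorphic map on an open subset of a complex normed space is
norm-continuous.** [folklore] -/
theorem continuousOn_of_weakly_holomorphic' {f : P → F} {U : Set P} (hU : IsOpen U)
    (hw : ∀ φ : StrongDual ℂ F, DifferentiableOn ℂ (fun z => φ (f z)) U)
    (hb : ∀ z₀ ∈ U, ∃ r > 0, ∃ C : ℝ, ∀ z ∈ ball z₀ r, ‖f z‖ ≤ C) : ContinuousOn f U := by
  intro z₀ hz₀
  obtain ⟨r, hr, C, hC⟩ := hb z₀ hz₀
  obtain ⟨ε, hε, hεU⟩ := Metric.isOpen_iff.1 hU z₀ hz₀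
  set R := min r ε with hRdef
  have hR : 0 < R := lt_min hr hε
  have hRU : ball z₀ R ⊆ U := (ball_subset_ball (min_le_right _ _)).trans hεU
  have hRr : ball z₀ R ⊆ ball z₀ r := ball_subset_ball (min_le_left _ _)
  have hlip : ∀ z ∈ ball z₀ (R / 2), ‖f z - f z₀‖ ≤ 4 * C / R * ‖z - z₀‖ := fun z hz =>
    norm_sub_le_of_weakly_holomorphic' hR (fun φ => (hw φ).mono hRU) (fun z hz => hC z (hRr hz))
      hz (mem_ball_self (by positivity))
  refine ContinuousAt.continuousWithinAt ?_
  rw [ContinuousAt, tendsto_iff_norm_sub_tendsto_zero]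
  have h0 : Tendsto (fun z : P => 4 * C / R * ‖z - z₀‖) (𝓝 z₀) (𝓝 0) := by
    simpa using (tendsto_norm_sub_self z₀).const_mul (4 * C / R)
  refine squeeze_zero_norm' ?_ h0
  filter_upwards [isOpen_ball.mem_nhds (mem_ball_self (by positivity : (0 : ℝ) < R / 2))]
    with z hz
  rw [norm_norm]
  exact hlip z hz

/-- Slices of configurations: `dist (z with zᵢ := t) (z with zᵢ := t₀) ≤ dist t t₀`. [folklore] -/
theorem dist_update_update_le {n : ℕ} (z : Fin n → ℂ) (i : Fin n) (t t₀ : ℂ) :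
    dist (Function.update z i t) (Function.update z i t₀) ≤ dist t t₀ := by
  refine (dist_pi_le_iff dist_nonneg).2 fun j => ?_
  by_cases hj : j = i
  · subst hj; simp
  · simp [Function.update_of_ne hj]

/-- **Dunford's theorem in several variables**: a locally bounded map `f : ℂⁿ ⊇ U → F` into a
complex Banach space such that `φ ∘ f` is holomorphic on the open set `U` for every functional `φ`
is (jointly) holomorphic on `U` — norm-continuity from the Lipschitz estimate, holomorphy of the
coordinate slices from the one-variable theorem, and Osgood's lemma
(`Literature.Analysis.Complex.SCV.differentiableOn_of_continuousOn_of_differentiableOn_update`). [folklore] -/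
theorem differentiableOn_of_weakly_holomorphic_pi [CompleteSpace F] {n : ℕ}
    {f : (Fin n → ℂ) → F} {U : Set (Fin n → ℂ)} (hU : IsOpen U)
    (hw : ∀ φ : StrongDual ℂ F, DifferentiableOn ℂ (fun z => φ (f z)) U)
    (hb : ∀ z₀ ∈ U, ∃ r > 0, ∃ C : ℝ, ∀ z ∈ ball z₀ r, ‖f z‖ ≤ C) : DifferentiableOn ℂ f U := by
  refine SCV.differentiableOn_of_continuousOn_of_differentiableOn_update hU
    (continuousOn_of_weakly_holomorphic' hU hw hb) fun z _ i => ?_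
  have hupd : Differentiable ℂ fun t : ℂ => Function.update z i t :=
    fun t => (hasFDerivAt_update z t).differentiableAt
  have ho : IsOpen {t : ℂ | Function.update z i t ∈ U} := hU.preimage hupd.continuous
  refine differentiableOn_of_weakly_holomorphic ho (fun φ => ?_) (fun t₀ ht₀ => ?_)
  · exact (hw φ).comp hupd.differentiableOn fun t ht => ht
  · obtain ⟨r, hr, C, hC⟩ := hb _ ht₀
    refine ⟨r, hr, C, fun t ht => hC _ ?_⟩
    rw [mem_ball] at ht ⊢
    exact (dist_update_update_le z i t t₀).trans_lt ht

/-- Several-variable, analytic form. [folklore] -/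
theorem analyticOnNhd_of_weakly_holomorphic_pi [CompleteSpace F] {n : ℕ}
    {f : (Fin n → ℂ) → F} {U : Set (Fin n → ℂ)} (hU : IsOpen U)
    (hw : ∀ φ : StrongDual ℂ F, DifferentiableOn ℂ (fun z => φ (f z)) U)
    (hb : ∀ z₀ ∈ U, ∃ r > 0, ∃ C : ℝ, ∀ z ∈ ball z₀ r, ‖f z‖ ≤ C) : AnalyticOnNhd ℂ f U :=
  SCV.analyticOnNhd_of_differentiableOn (differentiableOn_of_weakly_holomorphic_pi hU hw hb) hU

end SCV

/-! ### Hilbert-space forms in several variables -/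

section HilbertSCV

variable {H : Type*} [NormedAddCommGroup H] [InnerProductSpace ℂ H]

/-- Weak holomorphy against the closed span, several variables (locally uniform limits of
holomorphic functions of several variables, `Literature.Analysis.Complex.SCV.differentiableOn_of_tendstoLocallyUniformlyOn`). [folklore] -/
theorem differentiableOn_inner_of_mem_topologicalClosure_span_pi {n : ℕ} {f : (Fin n → ℂ) → H}
    {U : Set (Fin n → ℂ)} (hU : IsOpen U)
    (hb : ∀ z₀ ∈ U, ∃ r > 0, ∃ C : ℝ, ∀ z ∈ ball z₀ r, ‖f z‖ ≤ C) {K : Set H}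
    (hhol : ∀ v ∈ K, DifferentiableOn ℂ (fun z => ⟪v, f z⟫_ℂ) U) {v : H}
    (hv : v ∈ (Submodule.span ℂ K).topologicalClosure) :
    DifferentiableOn ℂ (fun z => ⟪v, f z⟫_ℂ) U := by
  have hspan : ∀ u ∈ Submodule.span ℂ K, DifferentiableOn ℂ (fun z => ⟪u, f z⟫_ℂ) U := by
    intro u hu
    induction hu using Submodule.span_induction with
    | mem u hu => exact hhol u hu
    | zero => simp only [inner_zero_left]; exact differentiableOn_const _
    | add u u' _ _ hu hu' =>
      simp only [inner_add_left]; exact hu.add hu'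
    | smul a u _ hu =>
      simp only [inner_smul_left]; exact hu.const_mul _
  have hv' : v ∈ closure (Submodule.span ℂ K : Set H) := by
    rw [← Submodule.topologicalClosure_coe]; exact hv
  obtain ⟨u, hu, hux⟩ := mem_closure_iff_seq_limit.1 hv'
  -- locally uniform convergence of the matrix elements
  have hunif : TendstoLocallyUniformlyOn (fun j z => ⟪u j, f z⟫_ℂ) (fun z => ⟪v, f z⟫_ℂ)
      atTop U := by
    rw [Metric.tendstoLocallyUniformlyOn_iff]
    intro ε hε z₀ hz₀
    obtain ⟨r, hr, C, hC⟩ := hb z₀ hz₀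
    refine ⟨ball z₀ r, mem_nhdsWithin_of_mem_nhds (ball_mem_nhds _ hr), ?_⟩
    have hC0 : 0 ≤ C := (norm_nonneg _).trans (hC z₀ (mem_ball_self hr))
    have hδ : 0 < ε / (C + 1) := by positivity
    have hev : ∀ᶠ j in atTop, dist (u j) v < ε / (C + 1) := (Metric.tendsto_nhds.1 hux) _ hδ
    filter_upwards [hev] with j hj y hy
    rw [dist_eq_norm] at hj
    rw [dist_eq_norm, ← inner_sub_left]
    calc ‖⟪v - u j, f y⟫_ℂ‖ ≤ ‖v - u j‖ * ‖f y‖ := norm_inner_le_norm _ _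
      _ ≤ ε / (C + 1) * C := by
          rw [norm_sub_rev]
          exact mul_le_mul hj.le (hC y hy) (norm_nonneg _) hδ.le
      _ < ε := by
          rw [div_mul_eq_mul_div, div_lt_iff₀ (by positivity)]
          nlinarith
  exact SCV.differentiableOn_of_tendstoLocallyUniformlyOn hU (fun j => hspan _ (hu j)) hunif

/-- **Holomorphy from matrix elements, several variables**: `f : ℂⁿ ⊇ U → H` locally bounded with
`z ↦ ⟪v, f z⟫` holomorphic on `U` for all `v` in a set with dense span is (jointly, in norm)
holomorphic on `U`. [folklore] -/
theorem differentiableOn_of_inner_of_dense_pi [CompleteSpace H] {n : ℕ} {f : (Fin n → ℂ) → H}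
    {U : Set (Fin n → ℂ)} (hU : IsOpen U)
    (hb : ∀ z₀ ∈ U, ∃ r > 0, ∃ C : ℝ, ∀ z ∈ ball z₀ r, ‖f z‖ ≤ C) {K : Set H}
    (hK : (Submodule.span ℂ K).topologicalClosure = ⊤)
    (hhol : ∀ v ∈ K, DifferentiableOn ℂ (fun z => ⟪v, f z⟫_ℂ) U) : DifferentiableOn ℂ f U := by
  refine differentiableOn_of_weakly_holomorphic_pi hU (fun φ => ?_) hb
  set v : H := (InnerProductSpace.toDual ℂ H).symm φ with hvdef
  have hφ : ∀ x, φ x = ⟪v, x⟫_ℂ := fun x => by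
    rw [hvdef, ← InnerProductSpace.toDual_apply_apply, LinearIsometryEquiv.apply_symm_apply]
  simp only [hφ]
  exact differentiableOn_inner_of_mem_topologicalClosure_span_pi hU hb hhol (by rw [hK]; trivial)

/-- … and norm-continuous. [folklore] -/
theorem continuousOn_of_inner_of_dense_pi [CompleteSpace H] {n : ℕ} {f : (Fin n → ℂ) → H}
    {U : Set (Fin n → ℂ)} (hU : IsOpen U)
    (hb : ∀ z₀ ∈ U, ∃ r > 0, ∃ C : ℝ, ∀ z ∈ ball z₀ r, ‖f z‖ ≤ C) {K : Set H}
    (hK : (Submodule.span ℂ K).topologicalClosure = ⊤)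
    (hhol : ∀ v ∈ K, DifferentiableOn ℂ (fun z => ⟪v, f z⟫_ℂ) U) : ContinuousOn f U :=
  (differentiableOn_of_inner_of_dense_pi hU hb hK hhol).continuousOn

end HilbertSCV

end Literature.Analysis.Complex
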